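import Summits.ResolutionOfSingularities.ResolutionOfSingularities.Theorems.HomologicalConductorSurfaceTerminationGenusCover
import Literature.AlgebraicGeometry.Resolution.NonPrincipalLocus
import Literature.AlgebraicGeometry.Resolution.ResolutionFibreDimension
import Mathlib.AlgebraicGeometry.ZariskisMainTheorem
import HarnessLib

/-!
# Crux `NoZenoR` (stmt-ResolutionOfSingularities-19943) — Lipman (1.2) 1), global form: the points with INFINITE fibre of a
# proper birational morphism of surfaces are finitely many CLOSED points («`R¹h_*𝒪_Z` has support of dimension `≤ 0`»)

Route `ResolutionOfSingularities/HomologicalConductor` (cell decomp-res, hand leafhand-res-homologicalconduct-12 g1).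
OURS: AI-written, weaker than expert review; nothing here is a statement of the manuscript under review (Hironaka 2017).
SUPPORT level (`--supports stmt-19943`), counted 0.  Def-free, FACT-FREE.

For `h : Z → W` proper and birational between integral schemes with `Z` Noetherian of dimension `≤ 2`: a point `x` with
infinite fibre is CLOSED (an infinite fibre contains a non-trivial specialization `ζ ⤳ c`; a further specialization `x ⤳ x'`
would lift along the closed `h` to `c ⤳ c'`, giving a chain `η ⤳ ζ ⤳ c ⤳ c'` of length `3` in `Z`), and the set of such points is
FINITE (it is `h` of the complement of the open quasi-finite locus, Mathlib `Scheme.Hom.quasiFiniteLocus` — Zariski's Main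
Theorem — hence closed, and a closed set of closed points of a Noetherian scheme is finite).  This is the support statement of
Lipman's footnote (1), p. 200, for the proof of (1.2) 1).

* `exists_specializes_ne_of_infinite` — an infinite subset of a Noetherian sober space, closed under generic points of its
  irreducible parts, contains a non-trivial specialization;
* `finite_of_isClosed_of_forall_isClosed_singleton` — a closed set of closed points of a Noetherian scheme is finite;
* `isClosed_singleton_of_infinite_preimage` — infinite fibre ⇒ closed point;
* `finite_preimage_singleton_of_forall_quasiFiniteAt`, `finite_setOf_infinite_preimage` — the infinite-fibre locus is finite.

No crux, kill test or summit statement is proved; resolution of singularities in positive characteristic is NOT proved.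

## References
* J. Lipman, *Rational singularities …*, Publ. Math. IHÉS 36 (1969): proof of Prop. (1.2) 1), p. 200 footnote (1). [Lipman1969]
* The Stacks Project, Tags 02UP, 01TI (quasi-finite locus is open; Zariski's Main Theorem). [StacksProject]
-/

-- single-problem summit: the doubled namespace component `ResolutionOfSingularities` is forced
set_option linter.dupNamespace false

noncomputable section

namespace Summit.ResolutionOfSingularities.ResolutionOfSingularities.Theorems.NoZeno.RationalAscent

open CategoryTheory CategoryTheory.Limits AlgebraicGeometry TopologicalSpace
open Literature.AlgebraicGeometry.Resolution Literature.AlgebraicGeometry.Morphisms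
open Summit.ResolutionOfSingularities.ResolutionOfSingularities.Theorems.SurfaceTermination.GenusDescent

/-! ## Topology: infinite sets contain non-trivial specializations -/

/-- **An infinite subset of a Noetherian sober space which contains the generic points of the closures of its irreducible parts
contains two distinct points `ζ ⤳ c`.**  (Some irreducible component of the Noetherian subspace `F` is infinite; its closure has
a generic point `ζ ∈ F`, and any other point `c` of the component is a specialization of `ζ`.) [folklore] -/
theorem exists_specializes_ne_of_infinite {Z : Type} [TopologicalSpace Z] [NoetherianSpace Z] [QuasiSober Z]
    {F : Set Z} (hF : F.Infinite)
    (hgen : ∀ C : Set Z, C ⊆ F → IsIrreducible C → ∀ ζ, IsGenericPoint ζ (closure C) → ζ ∈ F) :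
    ∃ ζ ∈ F, ∃ c ∈ F, ζ ⤳ c ∧ ζ ≠ c := by
  classical
  -- some irreducible component of the subspace `F` is infinite
  have hcomp : (irreducibleComponents F).Finite := NoetherianSpace.finite_irreducibleComponents
  have hex : ∃ C ∈ irreducibleComponents F, C.Infinite := by
    by_contra hall
    apply hF
    have hall' : ∀ C ∈ irreducibleComponents F, C.Finite := fun C hC => by
      by_contra hCi
      exact hall ⟨C, hC, hCi⟩
    have huniv : (Set.univ : Set F).Finite := by
      refine (hcomp.biUnion hall').subset fun p _ => ?_
      exact Set.mem_biUnion (irreducibleComponent_mem_irreducibleComponents p) mem_irreducibleComponent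
    exact Set.finite_coe_iff.mp (Set.finite_univ_iff.mp huniv)
  obtain ⟨C, hC, hCinf⟩ := hex
  -- its image in `Z` is irreducible; take a generic point of its closure
  let C' : Set Z := Subtype.val '' C
  have hC'F : C' ⊆ F := by
    rintro _ ⟨p, -, rfl⟩; exact p.2
  have hC'irr : IsIrreducible C' := hC.1.image _ continuous_subtype_val.continuousOn
  obtain ⟨ζ, hζ⟩ := QuasiSober.sober hC'irr.closure isClosed_closure
  have hζF : ζ ∈ F := hgen C' hC'F hC'irr ζ hζ
  -- a point of the component other than `ζ`
  have hC'inf : C'.Infinite := hCinf.image Subtype.val_injective.injOn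
  obtain ⟨c, hcC', hcζ⟩ : ∃ c ∈ C', c ≠ ζ := by
    by_contra hall
    apply hC'inf
    refine (Set.finite_singleton ζ).subset fun c hc => ?_
    by_contra hcζ
    exact hall ⟨c, hc, hcζ⟩
  exact ⟨ζ, hζF, c, hC'F hcC', hζ.specializes (subset_closure hcC'), fun h => hcζ h.symm⟩

/-- **A closed set of closed points of a Noetherian scheme is finite.** [folklore] -/
theorem finite_of_isClosed_of_forall_isClosed_singleton {W : Scheme.{0}} [NoetherianSpace W]
    {S : Set W} (hS : IsClosed S) (hpt : ∀ x ∈ S, IsClosed ({x} : Set W)) : S.Finite := by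
  by_contra hinf
  obtain ⟨ζ, hζS, c, hcS, hζc, hne⟩ := exists_specializes_ne_of_infinite hinf
    (fun C hCS _ ζ hζ => hS.closure_subset_iff.mpr hCS hζ.mem)
  apply hne
  have hc : c ∈ closure ({ζ} : Set W) := specializes_iff_mem_closure.mp hζc
  rw [(hpt ζ hζS).closure_eq] at hc
  exact (Set.mem_singleton_iff.mp hc).symm

/-! ## Infinite fibres of a proper birational morphism of surfaces -/

/-- **An infinite fibre contains a non-trivial specialization** `ζ ⤳ c`, `h ζ = h c = x`, `ζ ≠ c`. [folklore] -/
theorem exists_specializes_ne_of_infinite_preimage {Z W : Scheme.{0}} [NoetherianSpace Z] (h : Z ⟶ W) {x : W}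
    (hx : (h ⁻¹' {x}).Infinite) : ∃ ζ c : Z, h ζ = x ∧ h c = x ∧ ζ ⤳ c ∧ ζ ≠ c := by
  obtain ⟨ζ, hζ, c, hc, hζc, hne⟩ := exists_specializes_ne_of_infinite hx fun C hCF hCirr ζ hζ => by
    -- `h ζ` and `x` specialize to each other
    obtain ⟨c₀, hc₀⟩ := hCirr.nonempty
    have h1 : h ζ ⤳ x := by
      have : ζ ⤳ c₀ := hζ.specializes (subset_closure hc₀)
      have h2 := this.map h.continuous
      rwa [show h c₀ = x from hCF hc₀] at h2
    have h2 : x ⤳ h ζ := by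
      rw [specializes_iff_mem_closure]
      have hmem : h ζ ∈ closure (h '' C) :=
        image_closure_subset_closure_image h.continuous ⟨ζ, hζ.mem, rfl⟩
      refine closure_mono ?_ hmem
      rintro _ ⟨z, hz, rfl⟩
      exact hCF hz
    show h ζ = x
    exact (h1.antisymm h2).eq
  exact ⟨ζ, c, hζ, hc, hζc, hne⟩

/-- **A point with infinite fibre under a proper birational morphism from a surface is closed**: `h : Z → W` universally
closed and birational, `Z`, `W` integral, `Z` Noetherian of dimension `≤ 2`; if `h⁻¹{x}` is infinite then `{x}` is closed.
(Otherwise a chain `η_Z ⤳ ζ ⤳ c ⤳ c'` of length `3` in `Z`.) [cite: Lipman1969, proof of Proposition (1.2) 1), p. 200 footnote (1)] -/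
theorem isClosed_singleton_of_infinite_preimage {Z W : Scheme.{0}} [IsIntegral Z] [IsIntegral W] [NoetherianSpace Z]
    (h : Z ⟶ W) [UniversallyClosed h] (hbir : IsBirational h) (hdimZ : topologicalKrullDim Z ≤ 2)
    {x : W} (hx : (h ⁻¹' {x}).Infinite) : IsClosed ({x} : Set W) := by
  haveI : IsDominant h := hbir.isDominant
  obtain ⟨ζ, c, hζ, hc, hζc, hne⟩ := exists_specializes_ne_of_infinite_preimage h hx
  -- `x` is not the generic point (its fibre is `{η_Z}`), so `ζ ≠ η_Z`
  have hxη : x ≠ genericPoint W := by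
    intro hxe
    apply hne
    rw [hbir.eq_genericPoint_of_apply_eq (hζ.trans hxe), hbir.eq_genericPoint_of_apply_eq (hc.trans hxe)]
  have hζη : ζ ≠ genericPoint Z := by
    intro e
    apply hxη
    rw [← hζ, e]
    exact Literature.AlgebraicGeometry.Motives.RatFn.genericPoint_eq_of_isDominant h
  by_contra hnot
  -- a proper specialization `x ⤳ x'`
  have hx' : ∃ x' : W, x ⤳ x' ∧ x' ≠ x := by
    by_contra hall
    apply hnot
    have hcl : closure ({x} : Set W) = {x} := by
      refine Set.Subset.antisymm (fun y hy => ?_) subset_closure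
      by_contra hyx
      exact hall ⟨y, specializes_iff_mem_closure.mpr hy, hyx⟩
    rw [← hcl]
    exact isClosed_closure
  obtain ⟨x', hxx', hx'x⟩ := hx'
  -- lift it along the closed map `h`
  have hsp : SpecializingMap h := h.isClosedMap.specializingMap
  obtain ⟨c', hcc', hc'⟩ := hsp (a := c) (b := x') (by rw [hc]; exact hxx')
  -- the strict chain `c' < c < ζ < η_Z`
  have lt1 : c' < c := by
    refine lt_of_le_not_ge (Scheme.le_iff_specializes.2 hcc') fun hle => hx'x ?_
    have h1 : c' ⤳ c := Scheme.le_iff_specializes.1 hle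
    have h2 : x' ⤳ x := by
      have := h1.map h.continuous
      rwa [hc', hc] at this
    exact (h2.antisymm hxx').eq
  have lt2 : c < ζ := by
    refine lt_of_le_not_ge (Scheme.le_iff_specializes.2 hζc) fun hle => hne ?_
    exact (hζc.antisymm (Scheme.le_iff_specializes.1 hle)).eq
  have lt3 : ζ < genericPoint Z := by
    refine lt_of_le_not_ge (Scheme.le_iff_specializes.2 ((genericPoint_spec Z).specializes (Set.mem_univ ζ)))
      fun hle => hζη ?_
    exact ((Scheme.le_iff_specializes.1 hle).antisymm ((genericPoint_spec Z).specializes (Set.mem_univ ζ))).eq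
  have h1 : Order.coheight c + 1 ≤ Order.coheight c' := Order.coheight_add_one_le lt1
  have h2 : Order.coheight ζ + 1 ≤ Order.coheight c := Order.coheight_add_one_le lt2
  have h3 : Order.coheight (genericPoint Z) + 1 ≤ Order.coheight ζ := Order.coheight_add_one_le lt3
  have h3' : (3 : ℕ∞) ≤ Order.coheight c' :=
    calc (3 : ℕ∞) ≤ Order.coheight (genericPoint Z) + 1 + 1 + 1 := by
          rw [add_assoc, add_assoc]; exact le_add_self
      _ ≤ Order.coheight ζ + 1 + 1 := by gcongr
      _ ≤ Order.coheight c + 1 := by gcongr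
      _ ≤ Order.coheight c' := h1
  have hdim := (coe_height_add_coheight_le_topologicalKrullDim c').trans hdimZ
  have h4 : ((3 : ℕ∞) : WithBot ℕ∞) ≤ ((2 : ℕ∞) : WithBot ℕ∞) :=
    (WithBot.coe_le_coe.mpr (h3'.trans le_add_self)).trans hdim
  exact absurd (WithBot.coe_le_coe.mp h4) (by decide)

/-- **All points over `x` quasi-finite ⇒ the fibre over `x` is finite** (for `h` proper): the standard step of Stacks 02UP —
over the open `V = W ∖ h(Z ∖ QF(h))` the restriction of `h` is locally quasi-finite and proper, hence finite, and `x ∈ V`.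
[cite: StacksProject, Tag 02UP] -/
theorem finite_preimage_singleton_of_forall_quasiFiniteAt {Z W : Scheme.{0}} (h : Z ⟶ W) [IsProper h] {x : W}
    (hqf : ∀ z : Z, h z = x → h.QuasiFiniteAt z) : (h ⁻¹' {x}).Finite := by
  let V : W.Opens := ⟨_, (h.isClosedMap _ h.quasiFiniteLocus.isOpen.isClosed_compl).isOpen_compl⟩
  have hxV : x ∈ V := by
    rintro ⟨z, hz, hzx⟩
    exact hz (hqf z hzx)
  haveI : LocallyQuasiFinite (h ∣_ V) := by
    rw [← Scheme.Hom.quasiFiniteLocus_eq_top_iff]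
    ext z
    have : h.QuasiFiniteAt ((h ⁻¹ᵁ V).ι z) := by by_contra H; exact z.2 ⟨_, H, by simp⟩
    rw [← Scheme.Hom.quasiFiniteAt_comp_iff_of_isOpenImmersion, ← morphismRestrict_ι,
      Scheme.Hom.quasiFiniteAt_comp_iff] at this
    simpa
  haveI : IsFinite (h ∣_ V) := .of_isProper_of_locallyQuasiFinite _
  have hfin := (h ∣_ V).finite_preimage_singleton ⟨x, hxV⟩
  -- `h⁻¹{x}` is the image of the fibre of `h|_V` over `x`
  refine (hfin.image Subtype.val).subset fun z hz => ?_
  have hzV : z ∈ h ⁻¹ᵁ V := by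
    show h z ∈ V
    rw [show h z = x from hz]; exact hxV
  refine ⟨⟨z, hzV⟩, ?_, rfl⟩
  show (h ∣_ V) ⟨z, hzV⟩ = ⟨x, hxV⟩
  exact Subtype.ext (by rw [morphismRestrict_base_coe]; exact hz)

/-- **The infinite-fibre locus of a proper birational morphism from a surface is finite**: `h : Z → W` proper birational,
`Z`, `W` integral with `Z`, `W` Noetherian and `dim Z ≤ 2` ⇒ `{x | h⁻¹{x} infinite}` is a finite set (of closed points,
`isClosed_singleton_of_infinite_preimage`).  It is `h(Z ∖ QF(h))`, closed; closed sets of closed points are finite.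
[cite: Lipman1969, proof of Proposition (1.2) 1), p. 200 footnote (1)] [cite: StacksProject, Tag 02UP] -/
theorem finite_setOf_infinite_preimage {Z W : Scheme.{0}} [IsIntegral Z] [IsIntegral W] [NoetherianSpace Z]
    [NoetherianSpace W] (h : Z ⟶ W) [IsProper h] (hbir : IsBirational h) (hdimZ : topologicalKrullDim Z ≤ 2) :
    {x : W | (h ⁻¹' {x}).Infinite}.Finite := by
  -- the infinite-fibre locus is `h (Z ∖ QF(h))`
  have heq : {x : W | (h ⁻¹' {x}).Infinite} = h '' (h.quasiFiniteLocus : Set Z)ᶜ := by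
    ext x
    constructor
    · intro hx
      by_contra hnot
      refine hx (finite_preimage_singleton_of_forall_quasiFiniteAt h fun z hzx => ?_)
      by_contra H
      exact hnot ⟨z, H, hzx⟩
    · rintro ⟨z, hz, rfl⟩ hfin
      apply hz
      have : Finite (h.fiber (h z)) := (h.fiberHomeo (h z)).finite_iff.mpr hfin
      exact Scheme.Hom.quasiFiniteAt_iff_isOpen_singleton_asFiber.mpr (isOpen_discrete _)
  have hclosed : IsClosed {x : W | (h ⁻¹' {x}).Infinite} := by
    rw [heq]
    exact h.isClosedMap _ h.quasiFiniteLocus.isOpen.isClosed_compl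
  exact finite_of_isClosed_of_forall_isClosed_singleton hclosed
    fun x hx => isClosed_singleton_of_infinite_preimage h hbir hdimZ hx

end Summit.ResolutionOfSingularities.ResolutionOfSingularities.Theorems.NoZeno.RationalAscent

end
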